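import Mathlib
import HarnessLib
import Literature.Analysis.FluidPDE.VectorCalculusProofs
import Literature.Analysis.FluidPDE.AxisymHouLiVariables
import Literature.Analysis.FluidPDE.WholeSpaceIBP
import Literature.Analysis.FluidPDE.TaoEnstrophyLocalisation
import Summits.NavierStokesRegularity.NavierStokesRegularity.Theorems.HalfSpaceWindowDoorCirculationCarryingRigidityTiltingFlux
import Summits.NavierStokesRegularity.NavierStokesRegularity.Theorems.HalfSpaceWindowDoorCirculationCarryingRigiditySubcriticalStretching
import Summits.NavierStokesRegularity.NavierStokesRegularity.Theorems.HalfSpaceWindowDoorCirculationCarryingRigidityPlaneFluxHeightWindow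

/-!
# Route `HalfSpaceWindowDoor`, crux `CirculationCarryingRigidity` (stmt-NavierStokesRegularity-25311) — the WINDOWED
# LAPLACIAN of the `e₃`-vorticity on a horizontal plane (lemma for the dynamic plane-flux law)

For a `C³` field `V` on `ℝ³` with vorticity `ω = curl V` (so `div ω = 0`) whose first and second vorticity derivatives are
bounded, the Laplacian of `ω₃ = ⟪ω, e₃⟫` tested against the centred Gaussian window on the plane `{x₃ = c}` splits as

  `∫ (Δω₃)(y,c) g_{L,0}(y) dy = − Σ_{i=0,1} ∫ (∂ᵢω₃)(y,c) ∂ᵢg_{L,0}(y) dy + Σ_{j=0,1} ∫ (∂₃ωⱼ)(y,c) ∂ⱼg_{L,0}(y) dy`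

(`integral_laplacian_omega3_mul_gaussWin`): the in-plane part `Δ_h ω₃` by one integration by parts in the plane (g0's
`…TiltingFlux.integral_fderiv_planePt_mul_gaussWin`), and the vertical part `∂₃²ω₃ = ∂₃(−∂₀ω₀ − ∂₁ω₁) = −∂₀(∂₃ω₀) − ∂₁(∂₃ω₁)`
(`div ω = 0`, symmetry of second derivatives) again by in-plane integration by parts.  No boundary or decay condition: the
window carries the integrability.  This is the Laplacian term of the DYNAMIC windowed plane-flux law
(`…PlaneFluxDynamics`): `∂ₜ ∫ ω₃ g = ∫ (Δω₃) g − ∫ [(v·∇)ω − (ω·∇)v]₃ g`.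

Seat ns-hsw-p1 g2 (LEAD of 25311, cell pub-ns-dss).  WHAT THIS IS NOT: not a statement about Navier–Stokes regularity;
calculus identities for windowed plane integrals of HYPOTHETICAL blow-up profiles; helper `--supports` 25311.
-/

noncomputable section

-- the summit and its single sub-problem share the name (CONVENTIONS §1), as in every Theorems file
set_option linter.dupNamespace false

namespace Summit.NavierStokesRegularity.NavierStokesRegularity.Theorems.HalfSpaceWindowDoorCirculationCarryingRigidityPlaneLaplacian

open MeasureTheory Set Function Filter Topology Metric
open scoped RealInnerProductSpace InnerProductSpace ENNReal Laplacian
open Literature.Analysis Literature.Analysis.FluidPDE Literature.Analysis.UnboundedOperators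
open Summit.NavierStokesRegularity.NavierStokesRegularity.Theorems.HalfSpaceWindowDoorCirculationCarryingRigidityDefs
open Summit.NavierStokesRegularity.NavierStokesRegularity.Theorems.HalfSpaceWindowDoorCirculationCarryingRigidityWindowedFlux
  (gaussWin_pos continuous_gaussWin integrable_gaussWin continuous_planePt)
open Summit.NavierStokesRegularity.NavierStokesRegularity.Theorems.HalfSpaceWindowDoorCirculationCarryingRigidityTiltingFlux
  (integral_fderiv_planePt_mul_gaussWin)
open Summit.NavierStokesRegularity.NavierStokesRegularity.Theorems.HalfSpaceWindowDoorCirculationCarryingRigiditySubcriticalStretching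
  (fderiv_inner_e3_apply laplacian_inner_e3)
open Summit.NavierStokesRegularity.NavierStokesRegularity.Theorems.HalfSpaceWindowDoorCirculationCarryingRigidityPlaneFluxHeightWindow
  (inner_e3_eq_apply abs_inner_e3_le contDiff_one_curl)
open Summit.NavierStokesRegularity.NavierStokesRegularity.Theorems.RellichScarScarRigidity (norm_fderiv_coord_le_opNorm)

variable {V : EuclideanSpace ℝ (Fin 3) → EuclideanSpace ℝ (Fin 3)}

/-! ### Calculus of the component functions -/

/-- The curl of a `C³` field is `C²`. -/
theorem contDiff_two_curl (hV : ContDiff ℝ 3 V) : ContDiff ℝ 2 (curl V) := by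
  rw [curl_eq_curlCLM_comp]
  exact curlCLM.contDiff.comp (hV.fderiv_right (by norm_cast))

/-- Norm of a directional derivative functional: `‖D(y ↦ DG(y) e)(x)‖ ≤ ‖D²G(x)‖ ‖e‖` for `C²` scalar `G`. -/
theorem norm_fderiv_fderiv_apply_le {G : EuclideanSpace ℝ (Fin 3) → ℝ} (hG : ContDiff ℝ 2 G)
    (x e : EuclideanSpace ℝ (Fin 3)) : ‖fderiv ℝ (fun y => fderiv ℝ G y e) x‖ ≤ ‖iteratedFDeriv ℝ 2 G x‖ * ‖e‖ := by
  have hd : DifferentiableAt ℝ (fderiv ℝ G) x := ((hG.fderiv_right (m := 1) le_rfl).differentiable one_ne_zero) x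
  rw [fderiv_clm_apply hd (differentiableAt_const e)]
  simp only [fderiv_fun_const, Pi.zero_apply, ContinuousLinearMap.comp_zero, zero_add]
  calc ‖(fderiv ℝ (fderiv ℝ G) x).flip e‖ ≤ ‖(fderiv ℝ (fderiv ℝ G) x).flip‖ * ‖e‖ := ContinuousLinearMap.le_opNorm _ _
    _ = ‖fderiv ℝ (fderiv ℝ G) x‖ * ‖e‖ := by rw [ContinuousLinearMap.opNorm_flip]
    _ = ‖iteratedFDeriv ℝ 2 G x‖ * ‖e‖ := by rw [← norm_iteratedFDeriv_fderiv, norm_iteratedFDeriv_one]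

/-- Mixed second partials commute: `∂_a(∂_b G) = ∂_b(∂_a G)` for `C²` scalar `G`. -/
theorem fderiv_fderiv_comm {G : EuclideanSpace ℝ (Fin 3) → ℝ} (hG : ContDiff ℝ 2 G) (x a b : EuclideanSpace ℝ (Fin 3)) :
    fderiv ℝ (fun y => fderiv ℝ G y b) x a = fderiv ℝ (fun y => fderiv ℝ G y a) x b := by
  have hd : DifferentiableAt ℝ (fderiv ℝ G) x := ((hG.fderiv_right (m := 1) le_rfl).differentiable one_ne_zero) x
  rw [fderiv_clm_apply hd (differentiableAt_const b), fderiv_clm_apply hd (differentiableAt_const a)]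
  simp only [fderiv_fun_const, Pi.zero_apply, ContinuousLinearMap.comp_zero, zero_add,
    ContinuousLinearMap.flip_apply]
  exact (hG.contDiffAt.isSymmSndFDerivAt (by simp)).eq a b

/-- `e₃`-component scalar of a `C²` field is `C²`, with the norms of its first two derivatives controlled by those of the
field. -/
theorem norm_iteratedFDeriv_two_inner_e3_le {W : EuclideanSpace ℝ (Fin 3) → EuclideanSpace ℝ (Fin 3)} (hW : ContDiff ℝ 2 W)
    (x : EuclideanSpace ℝ (Fin 3)) : ‖iteratedFDeriv ℝ 2 (fun y => ⟪W y, e3⟫) x‖ ≤ ‖iteratedFDeriv ℝ 2 W x‖ := by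
  have hfun : (fun y => ⟪W y, e3⟫) = (innerSL ℝ e3) ∘ W := by
    funext y; simp [real_inner_comm]
  rw [hfun]
  refine (ContinuousLinearMap.norm_iteratedFDeriv_comp_left (innerSL ℝ e3) hW.contDiffAt le_rfl).trans ?_
  rw [innerSL_apply_norm, show ‖e3‖ = 1 by rw [e3, PiLp.norm_single, norm_one], one_mul]

/-! ### The vertical second derivative through `div ω = 0` -/

/-- **`∂₃ω₃ = −∂₀ω₀ − ∂₁ω₁` as functions** (`div curl V = 0`), for the scalar `f = ⟪curl V, e₃⟫`. -/
theorem fderiv_inner_curl_e3_e3_eq (hV : ContDiff ℝ 3 V) :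
    (fun x => fderiv ℝ (fun y => ⟪curl V y, e3⟫) x e3) = fun x =>
      -(fderiv ℝ (fun y => curl V y 0) x (EuclideanSpace.single 0 1)) - fderiv ℝ (fun y => curl V y 1) x (EuclideanSpace.single 1 1) := by
  have hW2 := contDiff_two_curl hV
  have hWd : Differentiable ℝ (curl V) := hW2.differentiable two_ne_zero
  funext x
  have hdiv : VectorCalculus.divergence (curl V) x = 0 := divergence_curl_eq_zero_holds V (hV.of_le (by norm_cast)) x
  rw [divergence_eq_sum_three] at hdiv
  rw [fderiv_inner_e3_apply (hWd x), inner_e3_eq_apply, e3, FluidPDE.fderiv_coord_apply (hWd x) 0,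
    FluidPDE.fderiv_coord_apply (hWd x) 1]
  linarith

/-- **`∂₃²ω₃ = −∂₀(∂₃ω₀) − ∂₁(∂₃ω₁)`** at a point (the previous identity differentiated along `e₃`, mixed partials commuted). -/
theorem fderiv_fderiv_inner_curl_e3_eq (hV : ContDiff ℝ 3 V) (x : EuclideanSpace ℝ (Fin 3)) :
    fderiv ℝ (fun y => fderiv ℝ (fun z => ⟪curl V z, e3⟫) y e3) x e3 =
      -(fderiv ℝ (fun y => fderiv ℝ (fun z => curl V z 0) y e3) x (EuclideanSpace.single 0 1)) -
        fderiv ℝ (fun y => fderiv ℝ (fun z => curl V z 1) y e3) x (EuclideanSpace.single 1 1) := by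
  have hW2 := contDiff_two_curl hV
  have hG : ∀ i : Fin 3, ContDiff ℝ 2 (fun z => curl V z i) := fun i => (EuclideanSpace.proj (𝕜 := ℝ) i).contDiff.comp hW2
  have hdG : ∀ (i : Fin 3) (e : EuclideanSpace ℝ (Fin 3)), Differentiable ℝ (fun y => fderiv ℝ (fun z => curl V z i) y e) :=
    fun i e => (((hG i).fderiv_right (m := 1) le_rfl).clm_apply contDiff_const).differentiable one_ne_zero
  rw [fderiv_inner_curl_e3_e3_eq hV]
  rw [show (fun x => -(fderiv ℝ (fun y => curl V y 0) x (EuclideanSpace.single 0 1)) -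
      fderiv ℝ (fun y => curl V y 1) x (EuclideanSpace.single 1 1)) =
      (-(fun x => fderiv ℝ (fun y => curl V y 0) x (EuclideanSpace.single 0 1))) -
        fun x => fderiv ℝ (fun y => curl V y 1) x (EuclideanSpace.single 1 1) from rfl]
  rw [fderiv_sub ((hdG 0 _) x).neg ((hdG 1 _) x), fderiv_neg]
  simp only [FunLike.coe_sub, FunLike.coe_neg, Pi.sub_apply, Pi.neg_apply]
  rw [fderiv_fderiv_comm (hG 0) x e3 (EuclideanSpace.single 0 1), fderiv_fderiv_comm (hG 1) x e3 (EuclideanSpace.single 1 1)]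

/-! ### The windowed Laplacian identity -/

/-- **WINDOWED LAPLACIAN OF `ω₃` ON A HORIZONTAL PLANE.**  For a `C³` field `V` with `‖D(curl V)‖ ≤ M_w` and
`‖D²(curl V)‖ ≤ M_{w2}`, every `L > 0` and height `c` (with `f = ⟪curl V, e₃⟫`, `ωⱼ = (curl V)ⱼ`, `e₀, e₁` the horizontal frame):
`∫ (Δf)(y,c) g_{L,0}(y) dy = −(∫ ∂₀f ∂₀g + ∫ ∂₁f ∂₁g) + (∫ ∂₃ω₀ ∂₀g + ∫ ∂₃ω₁ ∂₁g)` (all evaluated at `(y,c)`, window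
derivatives at `y`), and the integrand on the left is integrable. -/
theorem integral_laplacian_omega3_mul_gaussWin (hV : ContDiff ℝ 3 V) {Mw Mw2 : ℝ}
    (hMw : ∀ x, ‖fderiv ℝ (curl V) x‖ ≤ Mw) (hMw2 : ∀ x, ‖iteratedFDeriv ℝ 2 (curl V) x‖ ≤ Mw2)
    {L : ℝ} (hL : 0 < L) (c : ℝ) :
    Integrable (fun y => (Δ fun z => ⟪curl V z, e3⟫) (planePt c y) * gaussWin L 0 y) ∧
      ∫ y, (Δ fun z => ⟪curl V z, e3⟫) (planePt c y) * gaussWin L 0 y =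
        -((∫ y, fderiv ℝ (fun z => ⟪curl V z, e3⟫) (planePt c y) (EuclideanSpace.single 0 1) *
              fderiv ℝ (gaussWin L 0) y (EuclideanSpace.single 0 1)) +
            ∫ y, fderiv ℝ (fun z => ⟪curl V z, e3⟫) (planePt c y) (EuclideanSpace.single 1 1) *
              fderiv ℝ (gaussWin L 0) y (EuclideanSpace.single 1 1)) +
          ((∫ y, fderiv ℝ (fun z => curl V z 0) (planePt c y) e3 * fderiv ℝ (gaussWin L 0) y (EuclideanSpace.single 0 1)) +
            ∫ y, fderiv ℝ (fun z => curl V z 1) (planePt c y) e3 * fderiv ℝ (gaussWin L 0) y (EuclideanSpace.single 1 1)) := by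
  have hW2 := contDiff_two_curl hV
  have hWd : Differentiable ℝ (curl V) := hW2.differentiable two_ne_zero
  set f : EuclideanSpace ℝ (Fin 3) → ℝ := fun z => ⟪curl V z, e3⟫ with hf
  have hf2 : ContDiff ℝ 2 f := hW2.inner ℝ contDiff_const
  have hG : ∀ i : Fin 3, ContDiff ℝ 2 (fun z => curl V z i) := fun i => (EuclideanSpace.proj (𝕜 := ℝ) i).contDiff.comp hW2
  have hMw0 : 0 ≤ Mw := (norm_nonneg _).trans (hMw 0)
  have he3 : ‖e3‖ = 1 := by rw [e3, PiLp.norm_single, norm_one]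
  -- the partial derivatives `∂_e f` and `∂₃ ω_j` as bounded `C¹` scalars with bounded gradient
  have hdf1 : ∀ e : EuclideanSpace ℝ (Fin 3), ContDiff ℝ 1 (fun y => fderiv ℝ f y e) := fun e =>
    (hf2.fderiv_right (m := 1) le_rfl).clm_apply contDiff_const
  have hdfB : ∀ (e : EuclideanSpace ℝ (Fin 3)), ‖e‖ = 1 → ∀ x, ‖fderiv ℝ f x e‖ ≤ Mw := by
    intro e he x
    rw [hf, fderiv_inner_e3_apply (hWd x), Real.norm_eq_abs]
    calc |⟪fderiv ℝ (curl V) x e, e3⟫| ≤ ‖fderiv ℝ (curl V) x e‖ := abs_inner_e3_le _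
      _ ≤ ‖fderiv ℝ (curl V) x‖ * ‖e‖ := ContinuousLinearMap.le_opNorm _ _
      _ ≤ Mw := by rw [he, mul_one]; exact hMw x
  have hdfM : ∀ (e : EuclideanSpace ℝ (Fin 3)), ‖e‖ = 1 → ∀ x, ‖fderiv ℝ (fun y => fderiv ℝ f y e) x‖ ≤ Mw2 := by
    intro e he x
    calc ‖fderiv ℝ (fun y => fderiv ℝ f y e) x‖ ≤ ‖iteratedFDeriv ℝ 2 f x‖ * ‖e‖ := norm_fderiv_fderiv_apply_le hf2 x e
      _ ≤ ‖iteratedFDeriv ℝ 2 (curl V) x‖ * 1 := by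
          rw [he]; exact mul_le_mul_of_nonneg_right (norm_iteratedFDeriv_two_inner_e3_le hW2 x) zero_le_one
      _ ≤ Mw2 := by rw [mul_one]; exact hMw2 x
  have hdG1 : ∀ j : Fin 3, ContDiff ℝ 1 (fun y => fderiv ℝ (fun z => curl V z j) y e3) := fun j =>
    ((hG j).fderiv_right (m := 1) le_rfl).clm_apply contDiff_const
  have hdGB : ∀ (j : Fin 3) x, ‖fderiv ℝ (fun z => curl V z j) x e3‖ ≤ Mw := by
    intro j x
    calc ‖fderiv ℝ (fun z => curl V z j) x e3‖ ≤ ‖fderiv ℝ (fun z => curl V z j) x‖ * ‖e3‖ := ContinuousLinearMap.le_opNorm _ _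
      _ ≤ ‖fderiv ℝ (curl V) x‖ * 1 := by
          rw [he3]; exact mul_le_mul_of_nonneg_right (norm_fderiv_coord_le_opNorm (hWd x) j) zero_le_one
      _ ≤ Mw := by rw [mul_one]; exact hMw x
  have hdGM : ∀ (j : Fin 3) x, ‖fderiv ℝ (fun y => fderiv ℝ (fun z => curl V z j) y e3) x‖ ≤ Mw2 := by
    intro j x
    have hcomp : (fun z => curl V z j) = (EuclideanSpace.proj (𝕜 := ℝ) j) ∘ curl V := rfl
    have hn : ‖iteratedFDeriv ℝ 2 (fun z => curl V z j) x‖ ≤ ‖iteratedFDeriv ℝ 2 (curl V) x‖ := by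
      rw [hcomp]
      refine (ContinuousLinearMap.norm_iteratedFDeriv_comp_left _ hW2.contDiffAt le_rfl).trans ?_
      have h1 : ‖(EuclideanSpace.proj j : EuclideanSpace ℝ (Fin 3) →L[ℝ] ℝ)‖ ≤ 1 :=
        ContinuousLinearMap.opNorm_le_bound _ zero_le_one fun v => by rw [one_mul]; exact PiLp.norm_apply_le v j
      exact (mul_le_mul_of_nonneg_right h1 (norm_nonneg _)).trans (by rw [one_mul])
    calc ‖fderiv ℝ (fun y => fderiv ℝ (fun z => curl V z j) y e3) x‖ ≤ ‖iteratedFDeriv ℝ 2 (fun z => curl V z j) x‖ * ‖e3‖ :=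
          norm_fderiv_fderiv_apply_le (hG j) x e3
      _ ≤ Mw2 := by rw [he3, mul_one]; exact hn.trans (hMw2 x)
  -- the three pure second derivatives
  have hsingle : ∀ i : Fin 3, ‖(EuclideanSpace.single i (1 : ℝ) : EuclideanSpace ℝ (Fin 3))‖ = 1 := fun i => by
    rw [PiLp.norm_single, norm_one]
  have hΔ : ∀ x, (Δ f) x = fderiv ℝ (fun y => fderiv ℝ f y (EuclideanSpace.single 0 1)) x (EuclideanSpace.single 0 1) +
      fderiv ℝ (fun y => fderiv ℝ f y (EuclideanSpace.single 1 1)) x (EuclideanSpace.single 1 1) +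
      fderiv ℝ (fun y => fderiv ℝ f y e3) x e3 := by
    intro x
    rw [laplacian_eq_sum_fderiv_fderiv (EuclideanSpace.basisFun (Fin 3) ℝ) hf2 x, Fin.sum_univ_three]
    simp only [EuclideanSpace.basisFun_apply, e3]
  -- integration by parts for the in-plane terms `i = 0, 1`
  obtain ⟨hI0, -, hE0⟩ := integral_fderiv_planePt_mul_gaussWin (hdf1 (EuclideanSpace.single 0 1))
    (hdfB _ (hsingle 0)) (hdfM _ (hsingle 0)) hL c 0 0
  obtain ⟨hI1, -, hE1⟩ := integral_fderiv_planePt_mul_gaussWin (hdf1 (EuclideanSpace.single 1 1))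
    (hdfB _ (hsingle 1)) (hdfM _ (hsingle 1)) hL c 0 1
  -- the vertical term through `div ω = 0`
  obtain ⟨hJ0, -, hF0⟩ := integral_fderiv_planePt_mul_gaussWin (hdG1 0) (hdGB 0) (hdGM 0) hL c 0 0
  obtain ⟨hJ1, -, hF1⟩ := integral_fderiv_planePt_mul_gaussWin (hdG1 1) (hdGB 1) (hdGM 1) hL c 0 1
  have e0 : (EuclideanSpace.single (Fin.castSucc (0 : Fin 2)) (1 : ℝ) : EuclideanSpace ℝ (Fin 3)) = EuclideanSpace.single 0 1 := rfl
  have e1 : (EuclideanSpace.single (Fin.castSucc (1 : Fin 2)) (1 : ℝ) : EuclideanSpace ℝ (Fin 3)) = EuclideanSpace.single 1 1 := rfl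
  rw [e0] at hI0 hE0 hJ0 hF0
  rw [e1] at hI1 hE1 hJ1 hF1
  have hvert : ∀ y, fderiv ℝ (fun y => fderiv ℝ f y e3) (planePt c y) e3 * gaussWin L 0 y =
      -(fderiv ℝ (fun y => fderiv ℝ (fun z => curl V z 0) y e3) (planePt c y) (EuclideanSpace.single 0 1) * gaussWin L 0 y) -
        fderiv ℝ (fun y => fderiv ℝ (fun z => curl V z 1) y e3) (planePt c y) (EuclideanSpace.single 1 1) * gaussWin L 0 y := by
    intro y
    rw [hf, fderiv_fderiv_inner_curl_e3_eq hV]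
    ring
  have hfun : (fun y => (Δ f) (planePt c y) * gaussWin L 0 y) = fun y =>
      (fderiv ℝ (fun y => fderiv ℝ f y (EuclideanSpace.single 0 1)) (planePt c y) (EuclideanSpace.single 0 1) * gaussWin L 0 y +
        fderiv ℝ (fun y => fderiv ℝ f y (EuclideanSpace.single 1 1)) (planePt c y) (EuclideanSpace.single 1 1) * gaussWin L 0 y) +
      (-(fderiv ℝ (fun y => fderiv ℝ (fun z => curl V z 0) y e3) (planePt c y) (EuclideanSpace.single 0 1) * gaussWin L 0 y) -
        fderiv ℝ (fun y => fderiv ℝ (fun z => curl V z 1) y e3) (planePt c y) (EuclideanSpace.single 1 1) * gaussWin L 0 y) := by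
    funext y
    rw [hΔ, ← hvert y]
    ring
  have hA : Integrable (fun y =>
      fderiv ℝ (fun y => fderiv ℝ f y (EuclideanSpace.single 0 1)) (planePt c y) (EuclideanSpace.single 0 1) * gaussWin L 0 y +
        fderiv ℝ (fun y => fderiv ℝ f y (EuclideanSpace.single 1 1)) (planePt c y) (EuclideanSpace.single 1 1) * gaussWin L 0 y) :=
    hI0.add hI1
  have hC : Integrable (fun y =>
      -(fderiv ℝ (fun y => fderiv ℝ (fun z => curl V z 0) y e3) (planePt c y) (EuclideanSpace.single 0 1) * gaussWin L 0 y)) :=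
    hJ0.neg
  have hB : Integrable (fun y =>
      -(fderiv ℝ (fun y => fderiv ℝ (fun z => curl V z 0) y e3) (planePt c y) (EuclideanSpace.single 0 1) * gaussWin L 0 y) -
        fderiv ℝ (fun y => fderiv ℝ (fun z => curl V z 1) y e3) (planePt c y) (EuclideanSpace.single 1 1) * gaussWin L 0 y) :=
    hC.sub hJ1
  have hint : Integrable (fun y => (Δ f) (planePt c y) * gaussWin L 0 y) := by
    rw [hfun]
    exact hA.add hB
  refine ⟨hint, ?_⟩
  rw [hfun, integral_add hA hB, integral_add hI0 hI1, integral_sub hC hJ1, integral_neg, hE0, hE1, hF0, hF1]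
  ring

end Summit.NavierStokesRegularity.NavierStokesRegularity.Theorems.HalfSpaceWindowDoorCirculationCarryingRigidityPlaneLaplacian

end
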